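import Mathlib
import Literature.NumberTheory.Transcendental.KZCalculusOver
import Summits.KontsevichZagierPeriods.KontsevichZagierPeriods.Theorems.SoloInformedProductCommOver
import Summits.KontsevichZagierPeriods.KontsevichZagierPeriods.Theorems.SoloInformedPeriodRingOver
import Summits.KontsevichZagierPeriods.KontsevichZagierPeriods.Theorems.SoloInformedRealScalars
import Summits.KontsevichZagierPeriods.KontsevichZagierPeriods.Theorems.SoloInformedRealPeriodAlgebra
import HarnessLib

/-!
# Real segments are scalars in `P_ℝ`: `⟦[[a, b]], 1⟧ = (b − a) • 1`

Statement hygiene for the real-parameter period ring `P_ℝ := SoloInformedPeriodRingOver ℝ`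
(the ring of the four-move calculus with `ℝ`-semialgebraic data, `SoloInformedPeriodRingOver`,
an `ℝ`-algebra by `SoloInformedRealPeriodAlgebra`).  The structure map of `P_ℝ` was described
abstractly (`soloInformed_algebraMap_real_apply : algebraMap ℝ P_ℝ c = ⟦[pt, c]⟧`, a
zero-dimensional representation with constant integrand `c`).  Here we record that the scalars
are realised by honest one-dimensional representations: for `a ≤ b` the class of the real segment
`[[a, b]] ⊂ ℝ¹` with integrand `1` is

* `⟦[[a, b]], 1⟧ = algebraMap ℝ P_ℝ (b − a) = (b − a) • 1`
  (`soloInformed_toPeriodOver_realSegmentRep`, `soloInformed_toPeriodOver_realSegmentRep_eq_smul_one`),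
  by ONE Newton–Leibniz move over the point (primitive `F(t) = t`,
  `soloInformed_of_realSegmentRep_sub_mem_newtonLeibnizRel`);
* in particular `⟦[[0, c]], 1⟧ = c • 1` for `0 ≤ c` (`soloInformed_toPeriodOver_realSegmentRep_zero_left`)
  and every non-degenerate segment class is a **unit** of `P_ℝ`
  (`soloInformed_isUnit_toPeriodOver_realSegmentRep`), with inverse the scalar `(b − a)⁻¹`.

So in `P_ℝ` the real line segments of all lengths collapse onto the scalar line `ℝ · 1`, in
contrast with the `ℚ`-calculus, where `⟦[[0, c]], 1⟧` is only defined for real algebraic `c`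
(semialgebraicity over `ℚ`).  This is the kernel form of a bookkeeping remark on real parameters;
it has no bearing on the period conjecture itself (which concerns `k = ℚ`, equivalently any real
algebraic coefficient field, `SoloInformedCoefficientInvariance`).

All statements are unconditional and sorry-free.
-/

noncomputable section

open Set MeasureTheory MvPolynomial
open Literature.ModelTheory.ExponentialFields Literature.NumberTheory.Transcendental

namespace Summit.KontsevichZagierPeriods.KontsevichZagierPeriods.Theorems

/-! ### The segment representation `[[a, b]], 1` over `ℝ` -/

/-- Membership in the box `Icc (fun _ => a) (fun _ => b) ⊂ ℝ¹` is the pair of inequalities on the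
last (only) coordinate. -/
theorem soloInformed_mem_Icc_fin_one_iff {a b : ℝ} {z : Fin 1 → ℝ} :
    z ∈ Icc (fun _ : Fin 1 => a) (fun _ => b) ↔ a ≤ z (Fin.last 0) ∧ z (Fin.last 0) ≤ b := by
  simp only [mem_Icc, Pi.le_def]
  constructor
  · rintro ⟨h₁, h₂⟩
    exact ⟨h₁ _, h₂ _⟩
  · rintro ⟨h₁, h₂⟩
    exact ⟨fun i => by rwa [Subsingleton.elim i (Fin.last 0)],
      fun i => by rwa [Subsingleton.elim i (Fin.last 0)]⟩

/-- The real segment `[[a, b]] ⊂ ℝ¹` is `ℝ`-semialgebraic. -/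
theorem soloInformed_isSemialgebraic_realSegment (a b : ℝ) :
    IsSemialgebraic ℝ (Icc (fun _ : Fin 1 => a) (fun _ => b)) := by
  have hset : Icc (fun _ : Fin 1 => a) (fun _ => b) =
      {x : Fin 1 → ℝ | aeval x (C a : MvPolynomial (Fin 1) ℝ) ≤
          aeval x (X (Fin.last 0) : MvPolynomial (Fin 1) ℝ)} ∩
        {x : Fin 1 → ℝ | aeval x (X (Fin.last 0) : MvPolynomial (Fin 1) ℝ) ≤
          aeval x (C b : MvPolynomial (Fin 1) ℝ)} := by
    ext z
    simp only [soloInformed_mem_Icc_fin_one_iff, mem_inter_iff, mem_setOf_eq, aeval_C, aeval_X,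
      Algebra.algebraMap_self, RingHom.id_apply]
  rw [hset]
  exact (isSemialgebraic_setOf_eval_le _ _).inter (isSemialgebraic_setOf_eval_le _ _)

/-- **The segment representation `[[a, b]], 1` over `ℝ`**: domain the box
`Icc (fun _ => a) (fun _ => b) ⊂ ℝ¹` (empty if `b < a`), integrand `1`. -/
def soloInformedRealSegmentRep (a b : ℝ) : KZOver.IntegralRep ℝ 1 where
  domain := Icc (fun _ => a) (fun _ => b)
  integrand := fun _ => 1
  isSemialgebraic_domain := soloInformed_isSemialgebraic_realSegment a b
  isSemialgebraicFunOn_integrand := by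
    simpa using isSemialgebraicFunOn_aeval (soloInformed_isSemialgebraic_realSegment a b)
      (1 : MvPolynomial (Fin 1) ℝ)
  integrableOn := integrableOn_const (hs := measure_Icc_lt_top.ne)

/-- The domain of `[[a, b]], 1`. -/
@[simp] theorem soloInformed_realSegmentRep_domain (a b : ℝ) :
    (soloInformedRealSegmentRep a b).domain = Icc (fun _ => a) (fun _ => b) := rfl

/-- The integrand of `[[a, b]], 1`. -/
@[simp] theorem soloInformed_realSegmentRep_integrand (a b : ℝ) (x : Fin 1 → ℝ) :
    (soloInformedRealSegmentRep a b).integrand x = 1 := rfl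

/-- **`value ([[a, b]], 1) = b − a`** for `a ≤ b` (the length of the segment). -/
theorem soloInformed_realSegmentRep_value {a b : ℝ} (hab : a ≤ b) :
    (soloInformedRealSegmentRep a b).value = b - a := by
  simp only [KZOver.IntegralRep.value, soloInformed_realSegmentRep_domain,
    soloInformed_realSegmentRep_integrand, setIntegral_const, smul_eq_mul, mul_one, measureReal_def]
  rw [Real.volume_Icc_pi_toReal (fun _ => hab)]
  simp

/-! ### One Newton–Leibniz move: `[[a, b]], 1 ∼ [pt, b − a]` -/

/-- **`[[[a, b]], 1] − [pt, b − a]` is a Newton–Leibniz relation** (`a ≤ b`): over the base point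
`pt = ℝ⁰` take the constant bounds `a ≤ b` and the primitive `F(t) = t`, whose fibre derivative is
the integrand `1`; then `F(b) − F(a) = b − a = (b − a) · 1` is the integrand of `[pt, b − a]`. -/
theorem soloInformed_of_realSegmentRep_sub_mem_newtonLeibnizRel {a b : ℝ} (hab : a ≤ b) :
    KZOver.of (soloInformedRealSegmentRep a b) -
        KZOver.of (soloInformedRealScaleRep (b - a) soloInformedUnitOver) ∈
      KZOver.newtonLeibnizRel ℝ := by
  refine ⟨0, soloInformedRealSegmentRep a b, soloInformedRealScaleRep (b - a) soloInformedUnitOver,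
    fun _ => a, fun _ => b, fun z => z (Fin.last 0), ?_, ?_, ?_, fun _ _ => hab, ?_, ?_, ?_, ?_, rfl⟩
  · exact (isSemialgebraicFunOn_aeval (soloInformedRealSegmentRep a b).isSemialgebraic_domain
      (X (Fin.last 0))).congr fun z _ => by simp
  · exact (isSemialgebraicFunOn_aeval
      (soloInformedRealScaleRep (b - a) soloInformedUnitOver).isSemialgebraic_domain
      (C a : MvPolynomial (Fin 0) ℝ)).congr fun z _ => by simp
  · exact (isSemialgebraicFunOn_aeval
      (soloInformedRealScaleRep (b - a) soloInformedUnitOver).isSemialgebraic_domain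
      (C b : MvPolynomial (Fin 0) ℝ)).congr fun z _ => by simp
  · ext z
    simp only [soloInformed_realSegmentRep_domain, mem_setOf_eq, soloInformed_realScaleRep_domain,
      soloInformed_unitOver_domain, mem_univ, true_and]
    exact soloInformed_mem_Icc_fin_one_iff
  · intro x _
    simp only [Fin.snoc_last]
    exact continuousOn_id
  · intro x _ t _
    simp only [Fin.snoc_last, soloInformed_realSegmentRep_integrand]
    exact hasDerivAt_id' t
  · intro x _
    simp only [Fin.snoc_last, soloInformed_realScaleRep_integrand, soloInformed_unitOver_integrand,
      mul_one]

/-- **`[[a, b]], 1 ∼ [pt, b − a]`** (equivalent over `ℝ`, for `a ≤ b`). -/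
theorem soloInformed_realSegmentRep_equivalent {a b : ℝ} (hab : a ≤ b) :
    KZOver.Equivalent (soloInformedRealSegmentRep a b)
      (soloInformedRealScaleRep (b - a) soloInformedUnitOver) :=
  KZOver.newtonLeibnizRel_subset_relations
    (soloInformed_of_realSegmentRep_sub_mem_newtonLeibnizRel hab)

/-! ### The class of a segment is a scalar -/

/-- **`⟦[[a, b]], 1⟧ = algebraMap ℝ P_ℝ (b − a)`** for `a ≤ b`. -/
theorem soloInformed_toPeriodOver_realSegmentRep {a b : ℝ} (hab : a ≤ b) :
    soloInformedToPeriodOver ℝ (KZOver.of (soloInformedRealSegmentRep a b)) =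
      algebraMap ℝ (SoloInformedPeriodRingOver ℝ) (b - a) := by
  rw [soloInformed_algebraMap_real_apply]
  exact soloInformed_toPeriodOver_of_eq_of_equivalent (soloInformed_realSegmentRep_equivalent hab)

/-- **`⟦[[a, b]], 1⟧ = (b − a) • 1`** in `P_ℝ`, for `a ≤ b`. -/
theorem soloInformed_toPeriodOver_realSegmentRep_eq_smul_one {a b : ℝ} (hab : a ≤ b) :
    soloInformedToPeriodOver ℝ (KZOver.of (soloInformedRealSegmentRep a b)) =
      (b - a) • (1 : SoloInformedPeriodRingOver ℝ) := by
  rw [soloInformed_toPeriodOver_realSegmentRep hab, Algebra.algebraMap_eq_smul_one]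

/-- **`⟦[[0, c]], 1⟧ = algebraMap ℝ P_ℝ c = c • 1`** for `0 ≤ c`. -/
theorem soloInformed_toPeriodOver_realSegmentRep_zero_left {c : ℝ} (hc : 0 ≤ c) :
    soloInformedToPeriodOver ℝ (KZOver.of (soloInformedRealSegmentRep 0 c)) =
      algebraMap ℝ (SoloInformedPeriodRingOver ℝ) c := by
  rw [soloInformed_toPeriodOver_realSegmentRep hc, sub_zero]

/-- Two segments of the same length have the same class in `P_ℝ` (translation invariance, here a
consequence of both being the scalar `b − a`). -/
theorem soloInformed_toPeriodOver_realSegmentRep_eq_of_length_eq {a b a' b' : ℝ} (hab : a ≤ b)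
    (hab' : a' ≤ b') (h : b - a = b' - a') :
    soloInformedToPeriodOver ℝ (KZOver.of (soloInformedRealSegmentRep a b)) =
      soloInformedToPeriodOver ℝ (KZOver.of (soloInformedRealSegmentRep a' b')) := by
  rw [soloInformed_toPeriodOver_realSegmentRep hab, soloInformed_toPeriodOver_realSegmentRep hab', h]

/-- `ev ⟦[[a, b]], 1⟧ = b − a`. -/
theorem soloInformed_evalPOver_realSegmentRep {a b : ℝ} (hab : a ≤ b) :
    soloInformedEvalPOver ℝ (soloInformedToPeriodOver ℝ (KZOver.of (soloInformedRealSegmentRep a b))) =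
      b - a := by
  rw [soloInformed_toPeriodOver_realSegmentRep hab, soloInformed_evalPOver_algebraMap]

/-! ### Units -/

/-- Non-zero real scalars are units of `P_ℝ`. -/
theorem soloInformed_isUnit_algebraMap_real {c : ℝ} (hc : c ≠ 0) :
    IsUnit (algebraMap ℝ (SoloInformedPeriodRingOver ℝ) c) :=
  (Ne.isUnit hc).map _

/-- **Every non-degenerate real segment class `⟦[[a, b]], 1⟧` (`a < b`) is a unit of `P_ℝ`.** -/
theorem soloInformed_isUnit_toPeriodOver_realSegmentRep {a b : ℝ} (hab : a < b) :
    IsUnit (soloInformedToPeriodOver ℝ (KZOver.of (soloInformedRealSegmentRep a b))) := by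
  rw [soloInformed_toPeriodOver_realSegmentRep hab.le]
  exact soloInformed_isUnit_algebraMap_real (sub_ne_zero.mpr hab.ne')

/-- The inverse explicitly: `⟦[[a, b]], 1⟧ · (b − a)⁻¹ = 1` in `P_ℝ` (`a < b`), the inverse being
the scalar `algebraMap ℝ P_ℝ (b − a)⁻¹ = ⟦[pt, (b − a)⁻¹]⟧`. -/
theorem soloInformed_toPeriodOver_realSegmentRep_mul_inv {a b : ℝ} (hab : a < b) :
    soloInformedToPeriodOver ℝ (KZOver.of (soloInformedRealSegmentRep a b)) *
        algebraMap ℝ (SoloInformedPeriodRingOver ℝ) (b - a)⁻¹ = 1 := by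
  rw [soloInformed_toPeriodOver_realSegmentRep hab.le, ← map_mul,
    mul_inv_cancel₀ (sub_ne_zero.mpr hab.ne'), map_one]

/-- **`⟦[[0, c]], 1⟧` is a unit of `P_ℝ` for every `c > 0`.** -/
theorem soloInformed_isUnit_toPeriodOver_realSegmentRep_zero_left {c : ℝ} (hc : 0 < c) :
    IsUnit (soloInformedToPeriodOver ℝ (KZOver.of (soloInformedRealSegmentRep 0 c))) :=
  soloInformed_isUnit_toPeriodOver_realSegmentRep hc

end Summit.KontsevichZagierPeriods.KontsevichZagierPeriods.Theorems
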